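import Literature.NumberTheory.ConnesConsani2021.SineIntegralAsymptotics
import Literature.NumberTheory.LFunctions.PowerOscillatoryIntegrals
import HarnessLib

/-!
# The sine–log integrals `∫₀^∞ e^{−εt} sin t · log t / t dt` in closed form, `∫₀^∞ sin t · log t / t dt = −πγ/2`,
# and the logarithmic asymptotics `∫₀^T Si(w)/w dw − (π/2) log T → (π/2)γ`

LINE 1 — FRAMING: RH-FREE classical analysis (Euler's constant in the sine–log integral,
Gradshteyn–Ryzhik 4.421 1); cell rh-crit, corpus C1, seat t12 g2, input «W2» of the lead writer's blueprint
for `CC2021_prop_2_2_iii` (the `S → ∞` limit of the `Si`-terms of the finite-`S` cut-off scaling-kernel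
trace identity, steps K3–K5); bears_on: W-C/W-P (K1 stmt `SoninTraceFormula`, boundary fact
`CC2021_prop_2_2_iii`).  WHAT THIS IS NOT: any claim about RH — nothing in this file mentions `ζ`, the
critical strip or RH, and nothing here bears on the truth of RH.

Sources.  A. Jeffrey, *Handbook of Mathematical Formulas and Integrals* (1995) [bib `Jeffrey1995`]:
§11.1.6.1 `ψ(1) = −γ` (p0143:L41 of the held text; Mathlib `Complex.hasDerivAt_Gamma_one`) and §15.2.1
eq. 13 `∫₀^∞ sin(ax)/x dx = (π/2) sign a` (p0161:L49; tree `tendsto_sinIntegral_atTop`, seat t2);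
K. N. Boyadzhiev, *Special Techniques for Solving Integrals* (2020) [bib `Boyadzhiev2020`], §4
(chunk p0073:L12–L22) "`∫₀^∞ e^{−st} ln t dt = −(1/s)(ln s + γ)`" — the tree's
`Literature.Probability.Distributions.integral_log_mul_exp_neg_mul_Ioi` (real `s`); here the same
Gamma-derivative mechanism is run at the complex point `s = ε − i`.  Connes–Consani 2021
[bib `ConnesConsani2021`], §2 p. 11 (the `Si`-terms of `δ`) and §5/App. B (the constant `log 4π + γ` of
the archimedean functional) are where these constants meet.

## What is here (theorems only: 0 definitions, 0 named facts)

Part A (the damped integral, PROVED in closed form):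
* `hasDerivAt_mellin_dampedSin` — the Mellin transform `M_ε(s) = ∫₀^∞ t^{s−1} e^{−εt} sin t dt` of the
  damped sine is differentiable at `s = 0` with derivative the Mellin transform of `log t · e^{−εt} sin t`
  (Mathlib `mellin_hasDerivAt_of_isBigO_rpow`);
* `mellin_dampedSin_ofReal` — for real `a > 0`: `M_ε(a) = Γ(a) · Im (1/(ε − i))^a` (the tree's
  `integral_cpow_mul_exp_neg_mul_Ioi_complex` at `r = ε − i`, imaginary part);
* **`integral_exp_neg_mul_sin_mul_log_div`** — for `ε > 0`:
  `∫₀^∞ e^{−εt} sin t · log t / t dt = (Re log(1/(ε−i)) − γ) · Im log(1/(ε−i))`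
  `= −arctan(1/ε) · (½ log(1+ε²) + γ)` (the right-derivative at `a = 0` of `a ↦ Γ(a+1) e^{aρ} sin(aφ)/a`);
* `tendsto_integral_exp_neg_mul_sin_mul_log_div` — its limit `−(π/2)γ` as `ε → 0⁺`.

Part B (the conditionally convergent integral, Gradshteyn–Ryzhik 4.421 1, PROVED by an Abelian argument):
* `tendsto_intervalIntegral_sin_mul_log_div` — `∫₀^T sin t · log t / t dt → −(π/2)γ` (`T → ∞`):
  `H(T) = ∫₀^T h` converges and is bounded (integration by parts on `[1,T]` against `−cos t log t/t`),
  `∫₀^∞ e^{−εt} h = ε∫₀^∞ e^{−εt} H = ∫₀^∞ e^{−u} H(u/ε) du → lim H` (dominated convergence), and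
  Part A names the limit.

Part C (the `Si`-logarithmic asymptotics, input «W2» as the lead writer typed it, PROVED):
* `integral_sinIntegral_div_eq` — `∫₀^T Si(w)/w dw = Si(T) log T − ∫₀^T sin w log w / w dw` (`T > 0`);
* **`tendsto_integral_sinIntegral_div_sub_log`** —
  `Tendsto (fun T ↦ (∫ w in (0:ℝ)..T, sinIntegral w / w) − π/2 · log T) atTop (𝓝 (π/2 · γ))`.

Part D (explicit forms): `re_log_one_div_ofReal_sub_I` / `im_log_one_div_ofReal_sub_I`
(`log(1/(ε−i)) = −½log(1+ε²) + i(π/2 − arctan ε)`), `integral_exp_neg_mul_sin_mul_log_div_explicit`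
(`= −(π/2 − arctan ε)(½log(1+ε²) + γ)`) and the damped Dirichlet integral
`integral_exp_neg_mul_sin_div : ∫₀^∞ e^{−εt} sin t/t dt = π/2 − arctan ε` (Boyadzhiev eq. (2.1)).

Part E: `integral_exp_neg_mul_sinIntegral : ∫₀^∞ e^{−εt} Si(t) dt = (π/2 − arctan ε)/ε` (the Laplace
transform of `Si`, by parts from Part D).
-/

noncomputable section

open Real MeasureTheory Set Filter Asymptotics intervalIntegral Complex
open scoped Topology ComplexConjugate

namespace Literature.NumberTheory.ConnesConsani2021

open Literature.NumberTheory.LFunctions.AFE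

/-! ## Part A. The damped sine as a Mellin datum -/

section Damped

/-- `‖e^{−εt} sin t‖ ≤ e^{−εt}` (as a complex number). [folklore] -/
private theorem norm_dampedSin_le (ε t : ℝ) :
    ‖(((Real.exp (-(ε * t)) * Real.sin t : ℝ)) : ℂ)‖ ≤ Real.exp (-(ε * t)) := by
  rw [Complex.norm_real, Real.norm_eq_abs, abs_mul, abs_of_pos (Real.exp_pos _)]
  calc Real.exp (-(ε * t)) * |Real.sin t| ≤ Real.exp (-(ε * t)) * 1 := by
        gcongr; exact Real.abs_sin_le_one t
    _ = Real.exp (-(ε * t)) := mul_one _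

/-- `‖e^{−εt} sin t‖ ≤ |t|` for `ε ≥ 0`, `t ≥ 0`. [folklore] -/
private theorem norm_dampedSin_le_self {ε t : ℝ} (hε : 0 ≤ ε) (ht : 0 ≤ t) :
    ‖(((Real.exp (-(ε * t)) * Real.sin t : ℝ)) : ℂ)‖ ≤ t := by
  rw [Complex.norm_real, Real.norm_eq_abs, abs_mul, abs_of_pos (Real.exp_pos _)]
  have h1 : Real.exp (-(ε * t)) ≤ 1 := Real.exp_le_one_iff.2 (by nlinarith)
  have h2 : |Real.sin t| ≤ t := (Real.abs_sin_le_abs (x := t)).trans (le_of_eq (abs_of_nonneg ht))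
  calc Real.exp (-(ε * t)) * |Real.sin t| ≤ 1 * t :=
        mul_le_mul h1 h2 (abs_nonneg _) zero_le_one
    _ = t := one_mul t

/-- The damped sine is continuous. [folklore] -/
private theorem continuous_dampedSin (ε : ℝ) :
    Continuous fun t : ℝ ↦ (((Real.exp (-(ε * t)) * Real.sin t : ℝ)) : ℂ) := by
  fun_prop

/-- **Differentiability of the Mellin transform of the damped sine at `s = 0`**: with
`f_ε(t) = e^{−εt} sin t` (`ε > 0`), `s ↦ ∫₀^∞ t^{s−1} f_ε(t) dt` is differentiable at `0` with derivative
`∫₀^∞ t^{−1} log t · f_ε(t) dt` (`f_ε = O(t)` at `0⁺`, exponentially small at `∞`).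
[cite: Boyadzhiev2020, §4 (chunk p0073:L12–L22), differentiation of the Gamma integral in the exponent] -/
theorem hasDerivAt_mellin_dampedSin {ε : ℝ} (hε : 0 < ε) :
    MellinConvergent (fun t : ℝ ↦ (Real.log t : ℂ) • ((((Real.exp (-(ε * t)) * Real.sin t : ℝ)) : ℂ))) 0 ∧
    HasDerivAt (mellin fun t : ℝ ↦ (((Real.exp (-(ε * t)) * Real.sin t : ℝ)) : ℂ))
      (mellin (fun t : ℝ ↦ (Real.log t : ℂ) • ((((Real.exp (-(ε * t)) * Real.sin t : ℝ)) : ℂ))) 0) 0 := by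
  have h := mellin_hasDerivAt_of_isBigO_rpow (E := ℂ) (a := 1) (b := -1) (s := 0)
    (f := fun t : ℝ ↦ (((Real.exp (-(ε * t)) * Real.sin t : ℝ)) : ℂ))
    ((continuous_dampedSin ε).continuousOn.locallyIntegrableOn measurableSet_Ioi) ?_ (by simp) ?_
    (by simp)
  · simpa using h
  · -- at `∞`: `‖f_ε‖ ≤ e^{−εt} = o(t^{−1})`
    have h1 : (fun t : ℝ ↦ Real.exp (-(ε * t))) =o[atTop] fun t : ℝ ↦ t ^ (-(1 : ℝ)) := by
      simpa [neg_mul] using isLittleO_exp_neg_mul_rpow_atTop hε (-(1 : ℝ))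
    refine (IsBigO.of_bound 1 ?_).trans h1.isBigO
    filter_upwards with t
    rw [one_mul, Real.norm_eq_abs, abs_of_pos (Real.exp_pos _)]
    exact norm_dampedSin_le ε t
  · -- at `0⁺`: `‖f_ε‖ ≤ t`
    refine IsBigO.of_bound 1 ?_
    filter_upwards [self_mem_nhdsWithin] with t ht
    have ht : 0 < t := ht
    rw [neg_neg, Real.rpow_one, one_mul, Real.norm_eq_abs, abs_of_pos ht]
    exact norm_dampedSin_le_self hε.le ht.le

/-- The Mellin transform of the damped sine at a REAL point `a` is the real integral
`∫₀^∞ t^{a−1} e^{−εt} sin t dt`. [folklore] -/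
private theorem mellin_dampedSin_ofReal_eq_integral (ε a : ℝ) :
    mellin (fun t : ℝ ↦ (((Real.exp (-(ε * t)) * Real.sin t : ℝ)) : ℂ)) (a : ℂ) =
      ((∫ t in Ioi (0 : ℝ), t ^ (a - 1) * (Real.exp (-(ε * t)) * Real.sin t) : ℝ) : ℂ) := by
  rw [mellin, ← integral_complex_ofReal]
  refine setIntegral_congr_fun measurableSet_Ioi fun t ht ↦ ?_
  have ht : 0 < t := ht
  simp only [smul_eq_mul]
  rw [show ((a : ℂ) - 1) = ((a - 1 : ℝ) : ℂ) by push_cast; ring, ← Complex.ofReal_cpow ht.le]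
  push_cast
  ring

/-- **`∫₀^∞ t^{a−1} e^{−εt} sin t dt = Γ(a) · Im (1/(ε−i))^a`** for real `a > 0`, `ε > 0`: the imaginary
part of `∫₀^∞ t^{a−1} e^{−(ε−i)t} dt = (1/(ε−i))^a Γ(a)`. [cite: Boyadzhiev2020, §4 (chunk p0073:L12–L22), "Γ(p) = s^p ∫₀^∞ t^{p−1} e^{−st} dt"] -/
theorem integral_rpow_mul_exp_neg_mul_sin {ε a : ℝ} (hε : 0 < ε) (ha : 0 < a) :
    ∫ t in Ioi (0 : ℝ), t ^ (a - 1) * (Real.exp (-(ε * t)) * Real.sin t) =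
      Real.Gamma a * ((1 / ((ε : ℂ) - I)) ^ (a : ℂ)).im := by
  set r : ℂ := (ε : ℂ) - I with hr
  have hrre : 0 < r.re := by simp [hr, hε]
  have hare : 0 < (a : ℂ).re := by simp [ha]
  have key := integral_cpow_mul_exp_neg_mul_Ioi_complex hare hrre
  -- imaginary parts: the integrand's imaginary part is `t^{a−1} e^{−εt} sin t`
  have hint : Integrable (fun u : ℝ ↦ (u : ℂ) ^ ((a : ℂ) - 1) * Complex.exp (-(r * u)))
      (volume.restrict (Ioi 0)) := by
    refine Integrable.mono' ((integrableOn_exp_neg_mul_mul_rpow hε (by linarith : -1 < a - 1)))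
      ?_ ?_
    · refine ContinuousOn.aestronglyMeasurable (fun u hu ↦ ?_) measurableSet_Ioi
      have hu : 0 < u := hu
      exact ((Complex.continuousAt_ofReal_cpow_const u ((a : ℂ) - 1) (Or.inr hu.ne')).mul
        (by fun_prop)).continuousWithinAt
    · refine (ae_restrict_iff' measurableSet_Ioi).2 (Eventually.of_forall fun u hu ↦ ?_)
      have hu : 0 < u := hu
      rw [norm_mul, show ((a : ℂ) - 1) = ((a - 1 : ℝ) : ℂ) by push_cast; ring,
        Complex.norm_cpow_eq_rpow_re_of_pos hu, Complex.ofReal_re, Complex.norm_exp]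
      simp [hr, mul_comm]
  have him := congrArg Complex.im key
  have him2 := _root_.integral_im hint
  simp only [RCLike.im_to_complex] at him2
  rw [← him2] at him
  have hfun : (fun u : ℝ ↦ ((u : ℂ) ^ ((a : ℂ) - 1) * Complex.exp (-(r * u))).im) =ᵐ[volume.restrict (Ioi 0)]
      fun u : ℝ ↦ u ^ (a - 1) * (Real.exp (-(ε * u)) * Real.sin u) := by
    refine (ae_restrict_iff' measurableSet_Ioi).2 (Eventually.of_forall fun u hu ↦ ?_)
    have hu : 0 < u := hu
    dsimp only
    rw [show ((a : ℂ) - 1) = ((a - 1 : ℝ) : ℂ) by push_cast; ring, ← Complex.ofReal_cpow hu.le]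
    simp [hr, Complex.exp_im, Complex.mul_re, Complex.mul_im, Complex.ofReal_re, Complex.ofReal_im]
  rw [integral_congr_ae hfun] at him
  rw [him, Complex.mul_im, Complex.Gamma_ofReal]
  simp [Complex.ofReal_re, Complex.ofReal_im]
  ring

/-! ### The closed form at real points and the right-derivative at `a = 0` -/

/-- `Im (1/(ε−i))^a = e^{aρ} sin(aφ)` with `ρ + iφ = log(1/(ε−i))`, for real `a`. [folklore] -/
private theorem im_cpow_ofReal (ε a : ℝ) :
    ((1 / ((ε : ℂ) - I)) ^ (a : ℂ)).im =
      Real.exp (a * (Complex.log (1 / ((ε : ℂ) - I))).re) *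
        Real.sin (a * (Complex.log (1 / ((ε : ℂ) - I))).im) := by
  have hne : (1 / ((ε : ℂ) - I)) ≠ 0 := by
    refine one_div_ne_zero (sub_ne_zero.2 fun h ↦ ?_)
    have := congrArg Complex.im h
    simp at this
  rw [Complex.cpow_def_of_ne_zero hne, Complex.exp_im, Complex.mul_re, Complex.mul_im,
    Complex.ofReal_re, Complex.ofReal_im]
  congr 1 <;> congr 1 <;> ring

/-- `φ · sinc(aφ) = sin(aφ)/a` for `a ≠ 0`. [folklore] -/
private theorem mul_sinc_mul_eq_div {a : ℝ} (ha : a ≠ 0) (φ : ℝ) :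
    φ * Real.sinc (a * φ) = Real.sin (a * φ) / a := by
  rcases eq_or_ne φ 0 with hφ | hφ
  · simp [hφ]
  · rw [Real.sinc_of_ne_zero (mul_ne_zero ha hφ), mul_comm, div_mul_eq_mul_div,
      mul_div_mul_right _ _ hφ]

/-- **The damped sine integral in closed form at real `a > 0`**:
`∫₀^∞ t^{a−1} e^{−εt} sin t dt = Γ(a+1) e^{aρ} φ sinc(aφ)` (`ρ + iφ = log(1/(ε−i))`), the product form
whose right-derivative at `a = 0` is elementary. [cite: Boyadzhiev2020, §4 (chunk p0073:L12–L22)] -/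
theorem integral_rpow_mul_exp_neg_mul_sin_eq {ε a : ℝ} (hε : 0 < ε) (ha : 0 < a) :
    ∫ t in Ioi (0 : ℝ), t ^ (a - 1) * (Real.exp (-(ε * t)) * Real.sin t) =
      Real.Gamma (a + 1) * Real.exp (a * (Complex.log (1 / ((ε : ℂ) - I))).re) *
        ((Complex.log (1 / ((ε : ℂ) - I))).im *
          Real.sinc (a * (Complex.log (1 / ((ε : ℂ) - I))).im)) := by
  rw [integral_rpow_mul_exp_neg_mul_sin hε ha, im_cpow_ofReal, mul_sinc_mul_eq_div ha.ne',
    Real.Gamma_add_one ha.ne']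
  field_simp

/-- `a ↦ sinc(aφ)` has derivative `0` at `a = 0` (`|sinc y − 1| ≤ y²/6`). [folklore] -/
private theorem hasDerivAt_sinc_mul_zero (φ : ℝ) :
    HasDerivAt (fun a : ℝ ↦ Real.sinc (a * φ)) 0 0 := by
  rw [hasDerivAt_iff_isLittleO]
  simp only [zero_mul, Real.sinc_zero, sub_zero, smul_zero]
  have hbound : ∀ a : ℝ, ‖Real.sinc (a * φ) - 1‖ ≤ φ ^ 2 / 6 * ‖a ^ 2‖ := by
    intro a
    rw [Real.norm_eq_abs, Real.norm_eq_abs, abs_of_nonneg (sq_nonneg a)]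
    rcases eq_or_ne (a * φ) 0 with h0 | h0
    · rw [h0, Real.sinc_zero, sub_self, abs_zero]; positivity
    · rw [Real.sinc_of_ne_zero h0]
      have h1 : Real.sin (a * φ) / (a * φ) - 1 = -((a * φ - Real.sin (a * φ)) / (a * φ)) := by
        rw [sub_div, div_self h0]; ring
      rw [h1, abs_neg, abs_div]
      have h2 := Real.abs_sub_sin_le (a * φ)
      rw [div_le_iff₀ (abs_pos.2 h0)]
      calc |a * φ - Real.sin (a * φ)| ≤ |a * φ| ^ 3 / 6 := h2
        _ = φ ^ 2 / 6 * a ^ 2 * |a * φ| := by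
            rw [pow_succ, abs_mul, mul_pow, sq_abs, sq_abs]; ring
  have hO : (fun a : ℝ ↦ Real.sinc (a * φ) - 1) =O[𝓝 0] fun a : ℝ ↦ a ^ 2 :=
    IsBigO.of_bound (φ ^ 2 / 6) (Eventually.of_forall hbound)
  have ho : (fun a : ℝ ↦ a ^ 2) =o[𝓝 0] fun a : ℝ ↦ a := isLittleO_pow_id one_lt_two
  exact hO.trans_isLittleO ho

/-- **The right-derivative at `a = 0` of the product form**:
`d/da|_{a=0} [Γ(a+1) e^{aρ} · φ sinc(aφ)] = (ρ − γ) φ` (`Γ′(1) = −γ`, `sinc′(0) = 0`).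
[cite: Jeffrey1995, §11.1.6.1 eq. ψ(1) = −γ (p0143:L41)] -/
theorem hasDerivAt_productForm_zero (ρ φ : ℝ) :
    HasDerivAt (fun a : ℝ ↦ Real.Gamma (a + 1) * Real.exp (a * ρ) * (φ * Real.sinc (a * φ)))
      ((ρ - Real.eulerMascheroniConstant) * φ) 0 := by
  have hG : HasDerivAt (fun a : ℝ ↦ Real.Gamma (a + 1)) (-Real.eulerMascheroniConstant) 0 := by
    have h : HasDerivAt Real.Gamma (-Real.eulerMascheroniConstant) ((0 : ℝ) + 1) := by
      rw [zero_add]; exact Real.hasDerivAt_Gamma_one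
    exact h.comp_add_const 0 1
  have hE : HasDerivAt (fun a : ℝ ↦ Real.exp (a * ρ)) ρ 0 := by
    have h := ((hasDerivAt_id (0 : ℝ)).mul_const ρ).exp
    simpa using h
  have hQ : HasDerivAt (fun a : ℝ ↦ φ * Real.sinc (a * φ)) 0 0 := by
    simpa using (hasDerivAt_sinc_mul_zero φ).const_mul φ
  have hPQ := (hG.mul hE).mul hQ
  refine hPQ.congr_deriv ?_
  simp only [zero_mul, Real.exp_zero, zero_add, Real.Gamma_one, Real.sinc_zero, mul_one, mul_zero,
    add_zero]
  ring

/-- The Mellin transform of `log t · e^{−εt} sin t` at `0` is the real integral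
`∫₀^∞ e^{−εt} sin t · log t / t dt`. [folklore] -/
private theorem mellin_log_dampedSin_zero (ε : ℝ) :
    mellin (fun t : ℝ ↦ (Real.log t : ℂ) • ((((Real.exp (-(ε * t)) * Real.sin t : ℝ)) : ℂ))) 0 =
      ((∫ t in Ioi (0 : ℝ), Real.exp (-(ε * t)) * Real.sin t * Real.log t / t : ℝ) : ℂ) := by
  rw [mellin, ← integral_complex_ofReal]
  refine setIntegral_congr_fun measurableSet_Ioi fun t ht ↦ ?_
  have ht : 0 < t := ht
  simp only [smul_eq_mul, zero_sub]
  rw [show (-1 : ℂ) = ((-1 : ℝ) : ℂ) by norm_num, ← Complex.ofReal_cpow ht.le, Real.rpow_neg_one]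
  push_cast
  field_simp

/-- **The damped sine–log integral in closed form** (`ε > 0`):
`∫₀^∞ e^{−εt} sin t · log t / t dt = (ρ − γ) φ`, where `ρ + iφ = log(1/(ε − i))`, i.e.
`ρ = −½ log(1 + ε²)` and `φ = arctan(1/ε)`: the right-derivative at `a = 0` of the Gamma integral
`∫₀^∞ t^{a−1} e^{−εt} sin t dt = Γ(a) Im(1/(ε−i))^a`, with `Γ′(1) = −γ`.
[cite: Boyadzhiev2020, §4 (chunk p0073:L12–L22) "∫₀^∞ e^{−st} ln t dt = −(1/s)(ln s + γ)", run at the complex point s = ε − i; Jeffrey1995, §11.1.6.1 (p0143:L41) ψ(1) = −γ] -/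
theorem integral_exp_neg_mul_sin_mul_log_div {ε : ℝ} (hε : 0 < ε) :
    ∫ t in Ioi (0 : ℝ), Real.exp (-(ε * t)) * Real.sin t * Real.log t / t =
      ((Complex.log (1 / ((ε : ℂ) - I))).re - Real.eulerMascheroniConstant) *
        (Complex.log (1 / ((ε : ℂ) - I))).im := by
  set ρ := (Complex.log (1 / ((ε : ℂ) - I))).re with hρ
  set φ := (Complex.log (1 / ((ε : ℂ) - I))).im with hφ
  set f : ℝ → ℂ := fun t ↦ (((Real.exp (-(ε * t)) * Real.sin t : ℝ)) : ℂ) with hf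
  set M : ℝ → ℝ := fun a ↦ Real.Gamma (a + 1) * Real.exp (a * ρ) * (φ * Real.sinc (a * φ)) with hM
  obtain ⟨-, hder⟩ := hasDerivAt_mellin_dampedSin hε
  -- (1) for real `a > 0`: `mellin f a = M a`
  have hreal : ∀ a : ℝ, 0 < a → mellin f (a : ℂ) = ((M a : ℝ) : ℂ) := by
    intro a ha
    rw [hf, mellin_dampedSin_ofReal_eq_integral, integral_rpow_mul_exp_neg_mul_sin_eq hε ha]
  have hMderiv : HasDerivAt M ((ρ - Real.eulerMascheroniConstant) * φ) 0 :=
    hasDerivAt_productForm_zero ρ φ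
  have hder' : HasDerivAt (mellin f) (mellin (fun t : ℝ ↦ (Real.log t : ℂ) • f t) 0)
      ((0 : ℝ) : ℂ) := by
    rw [Complex.ofReal_zero]; exact hder
  -- (2) `mellin f 0 = M 0` by continuity from the right
  have h0 : mellin f ((0 : ℝ) : ℂ) = ((M 0 : ℝ) : ℂ) := by
    have h1 : Tendsto (fun a : ℝ ↦ mellin f (a : ℂ)) (𝓝[>] 0) (𝓝 (mellin f ((0 : ℝ) : ℂ))) :=
      (hder'.continuousAt.tendsto.comp (Complex.continuous_ofReal.tendsto 0)).mono_left
        nhdsWithin_le_nhds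
    have h2 : Tendsto (fun a : ℝ ↦ mellin f (a : ℂ)) (𝓝[>] 0) (𝓝 ((M 0 : ℝ) : ℂ)) := by
      have hc : Tendsto (fun a : ℝ ↦ ((M a : ℝ) : ℂ)) (𝓝[>] 0) (𝓝 ((M 0 : ℝ) : ℂ)) :=
        ((Complex.continuous_ofReal.tendsto (M 0)).comp hMderiv.continuousAt.tendsto).mono_left
          nhdsWithin_le_nhds
      refine hc.congr' ?_
      filter_upwards [self_mem_nhdsWithin] with a ha
      exact (hreal a ha).symm
    exact tendsto_nhds_unique h1 h2
  -- (3) identify the derivative with the right-derivative of `M` at `0`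
  have hm : HasDerivWithinAt (fun a : ℝ ↦ mellin f (a : ℂ))
      (mellin (fun t : ℝ ↦ (Real.log t : ℂ) • f t) 0) (Ioi 0) 0 :=
    hder'.comp_ofReal.hasDerivWithinAt
  have hMc : HasDerivWithinAt (fun a : ℝ ↦ ((M a : ℝ) : ℂ))
      ((((ρ - Real.eulerMascheroniConstant) * φ : ℝ)) : ℂ) (Ioi 0) 0 :=
    hMderiv.ofReal_comp.hasDerivWithinAt
  have hcongr : HasDerivWithinAt (fun a : ℝ ↦ mellin f (a : ℂ))
      ((((ρ - Real.eulerMascheroniConstant) * φ : ℝ)) : ℂ) (Ioi 0) 0 := by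
    refine hMc.congr_of_eventuallyEq ?_ h0
    filter_upwards [self_mem_nhdsWithin] with a ha
    exact hreal a ha
  have hD : mellin (fun t : ℝ ↦ (Real.log t : ℂ) • f t) 0 =
      ((((ρ - Real.eulerMascheroniConstant) * φ : ℝ)) : ℂ) := by
    rw [← hm.derivWithin (uniqueDiffWithinAt_Ioi (0 : ℝ)),
      hcongr.derivWithin (uniqueDiffWithinAt_Ioi (0 : ℝ))]
  rw [hf, mellin_log_dampedSin_zero] at hD
  exact_mod_cast hD

/-- `1/(0 − i) = i`. [folklore] -/
private theorem one_div_zero_sub_I : (1 : ℂ) / (((0 : ℝ) : ℂ) - I) = I := by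
  rw [Complex.ofReal_zero, zero_sub, div_neg, one_div, Complex.inv_I, neg_neg]

/-- **The limit `ε → 0⁺` of the closed form is `−(π/2)γ`** (`log(1/(ε−i)) → log i = iπ/2`).
[cite: Jeffrey1995, §11.1.6.1 (p0143:L41) and §15.2.1 eq. 13 (p0161:L49)] -/
theorem tendsto_closedForm_nhdsWithin_zero :
    Tendsto (fun ε : ℝ ↦ ((Complex.log (1 / ((ε : ℂ) - I))).re - Real.eulerMascheroniConstant) *
        (Complex.log (1 / ((ε : ℂ) - I))).im) (𝓝[>] 0)
      (𝓝 (-(π / 2 * Real.eulerMascheroniConstant))) := by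
  have hcont : ContinuousAt (fun ε : ℝ ↦ Complex.log (1 / ((ε : ℂ) - I))) 0 := by
    have h1 : ContinuousAt (fun ε : ℝ ↦ (1 / ((ε : ℂ) - I))) 0 := by
      refine ContinuousAt.div continuousAt_const (by fun_prop) ?_
      rw [Complex.ofReal_zero, zero_sub, neg_ne_zero]
      exact Complex.I_ne_zero
    have h2 : ContinuousAt Complex.log (1 / (((0 : ℝ) : ℂ) - I)) := by
      apply continuousAt_clog
      rw [one_div_zero_sub_I, Complex.mem_slitPlane_iff]
      right; simp
    exact ContinuousAt.comp_of_eq h2 h1 rfl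
  have hval : Complex.log (1 / (((0 : ℝ) : ℂ) - I)) = (π / 2 : ℝ) * I := by
    rw [one_div_zero_sub_I, Complex.log_I]; push_cast; ring
  have hre : Tendsto (fun ε : ℝ ↦ (Complex.log (1 / ((ε : ℂ) - I))).re) (𝓝 0) (𝓝 0) := by
    have h := (Complex.continuous_re.continuousAt.tendsto.comp hcont.tendsto)
    rw [hval] at h
    simpa [Function.comp_def] using h
  have him : Tendsto (fun ε : ℝ ↦ (Complex.log (1 / ((ε : ℂ) - I))).im) (𝓝 0) (𝓝 (π / 2)) := by
    have h := (Complex.continuous_im.continuousAt.tendsto.comp hcont.tendsto)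
    rw [hval] at h
    simpa [Function.comp_def] using h
  have h := (hre.sub_const Real.eulerMascheroniConstant).mul him
  rw [show ((0 : ℝ) - Real.eulerMascheroniConstant) * (π / 2) = -(π / 2 * Real.eulerMascheroniConstant)
    by ring] at h
  exact h.mono_left nhdsWithin_le_nhds

/-- **`∫₀^∞ e^{−εt} sin t · log t / t dt → −(π/2)γ` as `ε → 0⁺`.**
[cite: Boyadzhiev2020, §4 (chunk p0073:L12–L22); Jeffrey1995, §11.1.6.1 (p0143:L41)] -/
theorem tendsto_integral_exp_neg_mul_sin_mul_log_div :
    Tendsto (fun ε : ℝ ↦ ∫ t in Ioi (0 : ℝ), Real.exp (-(ε * t)) * Real.sin t * Real.log t / t)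
      (𝓝[>] 0) (𝓝 (-(π / 2 * Real.eulerMascheroniConstant))) := by
  refine tendsto_closedForm_nhdsWithin_zero.congr' ?_
  filter_upwards [self_mem_nhdsWithin] with ε hε
  exact (integral_exp_neg_mul_sin_mul_log_div hε).symm

end Damped

/-! ## Part B. From the damped integral to `∫₀^T sin t · log t / t dt → −πγ/2`

An Abelian argument: with `h(t) = sin t · log t / t` and `H(T) = ∫₀^T h`, integration by parts on
`[1, T]` against `−cos t · log t / t` shows that `H(T)` converges (to some `Λ`) and is bounded; then
`∫₀^∞ e^{−εt} h = ε ∫₀^∞ e^{−εt} H(t) dt = ∫₀^∞ e^{−u} H(u/ε) du → Λ` as `ε → 0⁺` by dominated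
convergence, and Part A identifies `Λ = −πγ/2`. -/

section Abelian

/-- `|sin t · log t / t| ≤ |log t|`. [folklore] -/
private theorem abs_sin_mul_log_div_le (t : ℝ) : |Real.sin t * Real.log t / t| ≤ |Real.log t| := by
  rcases eq_or_ne t 0 with rfl | ht
  · simp
  · rw [abs_div, abs_mul, div_le_iff₀ (abs_pos.2 ht), mul_comm |Real.log t| |t|]
    exact mul_le_mul_of_nonneg_right Real.abs_sin_le_abs (abs_nonneg _)

/-- `sin·log/t` is measurable. [folklore] -/
private theorem measurable_sin_mul_log_div :
    Measurable fun t : ℝ ↦ Real.sin t * Real.log t / t :=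
  (Real.measurable_sin.mul Real.measurable_log).div measurable_id

/-- `h = sin·log/t` is integrable on every bounded interval (it is `O(|log t|)`). [folklore] -/
private theorem intervalIntegrable_sin_mul_log_div (a b : ℝ) :
    IntervalIntegrable (fun t : ℝ ↦ Real.sin t * Real.log t / t) volume a b := by
  refine (intervalIntegral.intervalIntegrable_log'.norm).mono_fun'
    measurable_sin_mul_log_div.aestronglyMeasurable (Eventually.of_forall fun t ↦ ?_)
  show ‖Real.sin t * Real.log t / t‖ ≤ ‖Real.log t‖
  rw [Real.norm_eq_abs, Real.norm_eq_abs]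
  exact abs_sin_mul_log_div_le t

/-- `H(T) = ∫₀^T h` is continuous. [folklore] -/
private theorem continuous_primitive_sin_mul_log_div :
    Continuous fun T : ℝ ↦ ∫ t in (0 : ℝ)..T, Real.sin t * Real.log t / t :=
  intervalIntegral.continuous_primitive (fun a b ↦ intervalIntegrable_sin_mul_log_div a b) 0

/-- `H′(T) = h(T)` for `T > 0`. [folklore] -/
private theorem hasDerivAt_primitive_sin_mul_log_div {T : ℝ} (hT : 0 < T) :
    HasDerivAt (fun u : ℝ ↦ ∫ t in (0 : ℝ)..u, Real.sin t * Real.log t / t)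
      (Real.sin T * Real.log T / T) T := by
  refine intervalIntegral.integral_hasDerivAt_right (intervalIntegrable_sin_mul_log_div 0 T)
    measurable_sin_mul_log_div.stronglyMeasurable.stronglyMeasurableAtFilter ?_
  exact ((Real.continuous_sin.continuousAt).mul (Real.continuousAt_log hT.ne')).div
    continuousAt_id hT.ne'

/-- Integration by parts on `[1, T]`:
`∫_1^T sin t log t / t dt = −cos T log T / T + ∫_1^T cos t (1 − log t)/t² dt`. [folklore] -/
private theorem integral_one_sin_mul_log_div_eq {T : ℝ} (hT : 1 ≤ T) :
    ∫ t in (1 : ℝ)..T, Real.sin t * Real.log t / t =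
      -(Real.cos T * Real.log T / T) +
        ∫ t in (1 : ℝ)..T, Real.cos t * (1 - Real.log t) / t ^ 2 := by
  have hk : ContinuousOn (fun t : ℝ ↦ Real.cos t * (1 - Real.log t) / t ^ 2) (Set.uIcc 1 T) := by
    refine fun t ht ↦ ContinuousAt.continuousWithinAt ?_
    rw [Set.uIcc_of_le hT] at ht
    have ht0 : t ≠ 0 := by linarith [ht.1]
    exact ((Real.continuous_cos.continuousAt).mul
      (continuousAt_const.sub (Real.continuousAt_log ht0))).div (continuousAt_id.pow 2)
      (pow_ne_zero 2 ht0)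
  have hkint : IntervalIntegrable (fun t : ℝ ↦ Real.cos t * (1 - Real.log t) / t ^ 2) volume 1 T :=
    hk.intervalIntegrable
  have hderiv : ∀ t ∈ Ioo 1 T, HasDerivAt (fun t : ℝ ↦ -(Real.cos t * Real.log t / t))
      (Real.sin t * Real.log t / t - Real.cos t * (1 - Real.log t) / t ^ 2) t := by
    intro t ht
    have ht0 : t ≠ 0 := by linarith [ht.1]
    have h := (((Real.hasDerivAt_cos t).mul (Real.hasDerivAt_log ht0)).div (hasDerivAt_id t)
      ht0).neg
    refine h.congr_deriv ?_
    simp only [id, Pi.mul_apply]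
    field_simp
    ring
  have hcont : ContinuousOn (fun t : ℝ ↦ -(Real.cos t * Real.log t / t)) (Icc 1 T) := by
    refine fun t ht ↦ ContinuousAt.continuousWithinAt ?_
    have ht0 : t ≠ 0 := by linarith [ht.1]
    exact (((Real.continuous_cos.continuousAt).mul (Real.continuousAt_log ht0)).div
      continuousAt_id ht0).neg
  have hint : IntervalIntegrable (fun t : ℝ ↦
      Real.sin t * Real.log t / t - Real.cos t * (1 - Real.log t) / t ^ 2) volume 1 T :=
    (intervalIntegrable_sin_mul_log_div 1 T).sub hkint
  have hFTC := intervalIntegral.integral_eq_sub_of_hasDerivAt_of_le hT hcont hderiv hint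
  rw [intervalIntegral.integral_sub (intervalIntegrable_sin_mul_log_div 1 T) hkint] at hFTC
  simp only [Real.log_one, mul_zero, zero_div, neg_zero, sub_zero] at hFTC
  linarith

/-- `k(t) = cos t (1 − log t)/t²` is integrable on `(1, ∞)` (`|k| ≤ 3 t^{−3/2}`). [folklore] -/
private theorem integrableOn_cos_mul_one_sub_log_div_sq :
    IntegrableOn (fun t : ℝ ↦ Real.cos t * (1 - Real.log t) / t ^ 2) (Ioi 1) := by
  have hint : IntegrableOn (fun t : ℝ ↦ 3 * t ^ (-(3 / 2 : ℝ))) (Ioi 1) :=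
    (integrableOn_Ioi_rpow_of_lt (by norm_num) zero_lt_one).const_mul 3
  refine hint.mono' ((Real.measurable_cos.mul (measurable_const.sub Real.measurable_log)).div
    (measurable_id.pow_const 2)).aestronglyMeasurable ?_
  refine (ae_restrict_iff' measurableSet_Ioi).2 (Eventually.of_forall fun t ht ↦ ?_)
  have ht : 1 < t := ht
  have ht0 : 0 < t := by linarith
  have hlog0 : 0 ≤ Real.log t := Real.log_nonneg ht.le
  have hlog : Real.log t ≤ 2 * t ^ (1 / 2 : ℝ) := by
    have := Real.log_le_rpow_div ht0.le (by norm_num : (0 : ℝ) < 1 / 2)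
    linarith
  have hone : 1 ≤ t ^ (1 / 2 : ℝ) := Real.one_le_rpow ht.le (by norm_num)
  rw [Real.norm_eq_abs, abs_div, abs_mul, abs_of_pos (pow_pos ht0 2),
    show (-(3 / 2 : ℝ)) = 1 / 2 - 2 by norm_num, Real.rpow_sub ht0, Real.rpow_two,
    ← mul_div_assoc]
  refine div_le_div_of_nonneg_right ?_ (pow_pos ht0 2).le
  calc |Real.cos t| * |1 - Real.log t| ≤ 1 * (1 + Real.log t) := by
        refine mul_le_mul (Real.abs_cos_le_one t) ?_ (abs_nonneg _) zero_le_one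
        exact (abs_sub _ _).trans (by rw [abs_one, abs_of_nonneg hlog0])
    _ ≤ 3 * t ^ (1 / 2 : ℝ) := by linarith

/-- **`H(T) = ∫₀^T sin t log t/t dt` converges as `T → ∞`**, to
`Λ = ∫₀^1 h + ∫_1^∞ cos t (1 − log t)/t² dt`. [folklore] -/
private theorem tendsto_primitive_sin_mul_log_div :
    Tendsto (fun T : ℝ ↦ ∫ t in (0 : ℝ)..T, Real.sin t * Real.log t / t) atTop
      (𝓝 ((∫ t in (0 : ℝ)..1, Real.sin t * Real.log t / t) +
        ∫ t in Ioi (1 : ℝ), Real.cos t * (1 - Real.log t) / t ^ 2)) := by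
  have h1 : Tendsto (fun T : ℝ ↦ Real.cos T * Real.log T / T) atTop (𝓝 0) := by
    have hl : Tendsto (fun T : ℝ ↦ Real.log T / T) atTop (𝓝 0) := by
      have := Real.tendsto_pow_log_div_mul_add_atTop 1 0 1 one_ne_zero
      simpa using this
    refine squeeze_zero_norm' ?_ hl
    filter_upwards [eventually_ge_atTop 1] with T hT
    have hT0 : 0 < T := by linarith
    rw [Real.norm_eq_abs, abs_div, abs_mul, abs_of_nonneg (Real.log_nonneg hT), abs_of_pos hT0]
    exact div_le_div_of_nonneg_right
      (mul_le_of_le_one_left (Real.log_nonneg hT) (Real.abs_cos_le_one T)) hT0.le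
  have h2 : Tendsto (fun T : ℝ ↦ ∫ t in (1 : ℝ)..T, Real.cos t * (1 - Real.log t) / t ^ 2) atTop
      (𝓝 (∫ t in Ioi (1 : ℝ), Real.cos t * (1 - Real.log t) / t ^ 2)) :=
    intervalIntegral_tendsto_integral_Ioi 1 integrableOn_cos_mul_one_sub_log_div_sq tendsto_id
  have h3 := (h1.neg.add h2).const_add (∫ t in (0 : ℝ)..1, Real.sin t * Real.log t / t)
  simp only [neg_zero, zero_add] at h3
  refine h3.congr' ?_
  filter_upwards [eventually_ge_atTop 1] with T hT
  rw [← integral_one_sin_mul_log_div_eq hT,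
    intervalIntegral.integral_add_adjacent_intervals (intervalIntegrable_sin_mul_log_div 0 1)
      (intervalIntegrable_sin_mul_log_div 1 T)]

/-- `H` is bounded on `[0, ∞)`. [folklore] -/
private theorem exists_bound_primitive_sin_mul_log_div :
    ∃ C : ℝ, ∀ T : ℝ, 0 ≤ T → ‖∫ t in (0 : ℝ)..T, Real.sin t * Real.log t / t‖ ≤ C := by
  set L := (∫ t in (0 : ℝ)..1, Real.sin t * Real.log t / t) +
    ∫ t in Ioi (1 : ℝ), Real.cos t * (1 - Real.log t) / t ^ 2 with hL
  have hT := tendsto_primitive_sin_mul_log_div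
  obtain ⟨T₀, hT₀⟩ := eventually_atTop.1 (hT.eventually (Metric.ball_mem_nhds L one_pos))
  obtain ⟨C₁, hC₁⟩ := (isCompact_Icc (a := (0 : ℝ)) (b := max T₀ 0)).exists_bound_of_continuousOn
    continuous_primitive_sin_mul_log_div.continuousOn
  refine ⟨max C₁ (‖L‖ + 1), fun T hT' ↦ ?_⟩
  rcases le_or_gt T (max T₀ 0) with h | h
  · exact (hC₁ T ⟨hT', h⟩).trans (le_max_left _ _)
  · have hd : dist (∫ t in (0 : ℝ)..T, Real.sin t * Real.log t / t) L < 1 :=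
      hT₀ T ((le_max_left _ _).trans h.le)
    refine le_trans ?_ (le_max_right _ _)
    have := norm_le_norm_add_norm_sub' (∫ t in (0 : ℝ)..T, Real.sin t * Real.log t / t) L
    rw [← dist_eq_norm] at this
    linarith

/-- `t ↦ e^{−εt} h(t)` is integrable on `(0, ∞)` (from the Mellin convergence of Part A). [folklore] -/
private theorem integrableOn_exp_neg_mul_sin_mul_log_div {ε : ℝ} (hε : 0 < ε) :
    IntegrableOn (fun t : ℝ ↦ Real.exp (-(ε * t)) * Real.sin t * Real.log t / t) (Ioi 0) := by
  have hconv := (hasDerivAt_mellin_dampedSin hε).1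
  rw [MellinConvergent] at hconv
  refine (hconv.norm).mono' ?_ ?_
  · exact (((Real.continuous_exp.comp (continuous_const.mul continuous_id).neg).measurable.mul
      Real.measurable_sin).mul Real.measurable_log).div measurable_id |>.aestronglyMeasurable
  · refine (ae_restrict_iff' measurableSet_Ioi).2 (Eventually.of_forall fun t ht ↦ le_of_eq ?_)
    have ht : 0 < t := ht
    rw [zero_sub, show (-1 : ℂ) = ((-1 : ℝ) : ℂ) by norm_num, ← Complex.ofReal_cpow ht.le,
      Real.rpow_neg_one]
    rw [smul_eq_mul, smul_eq_mul]
    norm_cast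
    rw [Real.norm_eq_abs, Real.norm_eq_abs]
    congr 1
    field_simp

/-- **Integration by parts against the primitive**:
`∫₀^∞ e^{−εt} h(t) dt = ε ∫₀^∞ e^{−εt} H(t) dt` (`ε > 0`, `H(T) = ∫₀^T h`, `h = sin·log/t`). [folklore] -/
private theorem integral_exp_neg_mul_sin_mul_log_div_eq_primitive {ε : ℝ} (hε : 0 < ε) :
    ∫ t in Ioi (0 : ℝ), Real.exp (-(ε * t)) * Real.sin t * Real.log t / t =
      ε * ∫ t in Ioi (0 : ℝ), Real.exp (-(ε * t)) *
        ∫ u in (0 : ℝ)..t, Real.sin u * Real.log u / u := by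
  set H : ℝ → ℝ := fun t ↦ ∫ u in (0 : ℝ)..t, Real.sin u * Real.log u / u with hHdef
  obtain ⟨C, hC⟩ := exists_bound_primitive_sin_mul_log_div
  have hHc : Continuous H := continuous_primitive_sin_mul_log_div
  have hexpc : Continuous fun t : ℝ ↦ Real.exp (-(ε * t)) := by fun_prop
  -- the finite-range identity
  have hfin : ∀ N : ℝ, 0 ≤ N →
      ∫ t in (0 : ℝ)..N, Real.exp (-(ε * t)) * Real.sin t * Real.log t / t =
        Real.exp (-(ε * N)) * H N + ε * ∫ t in (0 : ℝ)..N, Real.exp (-(ε * t)) * H t := by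
    intro N hN
    have hderiv : ∀ t ∈ Ioo 0 N, HasDerivAt (fun t : ℝ ↦ Real.exp (-(ε * t)) * H t)
        (-ε * Real.exp (-(ε * t)) * H t + Real.exp (-(ε * t)) * (Real.sin t * Real.log t / t))
        t := by
      intro t ht
      have h1 : HasDerivAt (fun t : ℝ ↦ Real.exp (-(ε * t))) (-ε * Real.exp (-(ε * t))) t := by
        have h0 : HasDerivAt (fun t : ℝ ↦ -(ε * t)) (-ε) t := by
          simpa [neg_mul] using (hasDerivAt_id t).const_mul (-ε)
        exact h0.exp.congr_deriv (by ring)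
      have h2 := hasDerivAt_primitive_sin_mul_log_div ht.1
      have := h1.mul h2
      refine this.congr_deriv ?_
      ring
    have hcont : ContinuousOn (fun t : ℝ ↦ Real.exp (-(ε * t)) * H t) (Icc 0 N) :=
      (hexpc.mul hHc).continuousOn
    have hi1 : IntervalIntegrable (fun t : ℝ ↦ -ε * Real.exp (-(ε * t)) * H t) volume 0 N :=
      ((continuous_const.mul hexpc).mul hHc).intervalIntegrable 0 N
    have hi2 : IntervalIntegrable (fun t : ℝ ↦
        Real.exp (-(ε * t)) * (Real.sin t * Real.log t / t)) volume 0 N :=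
      (intervalIntegrable_sin_mul_log_div 0 N).continuousOn_mul hexpc.continuousOn
    have hFTC := intervalIntegral.integral_eq_sub_of_hasDerivAt_of_le hN hcont hderiv (hi1.add hi2)
    rw [intervalIntegral.integral_add hi1 hi2] at hFTC
    have hH0 : H 0 = 0 := by simp [hHdef]
    rw [hH0, mul_zero, sub_zero] at hFTC
    have e1 : ∫ t in (0 : ℝ)..N, -ε * Real.exp (-(ε * t)) * H t =
        -(ε * ∫ t in (0 : ℝ)..N, Real.exp (-(ε * t)) * H t) := by
      rw [← intervalIntegral.integral_const_mul, ← intervalIntegral.integral_neg]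
      congr 1; funext t; ring
    have e2 : ∫ t in (0 : ℝ)..N, Real.exp (-(ε * t)) * (Real.sin t * Real.log t / t) =
        ∫ t in (0 : ℝ)..N, Real.exp (-(ε * t)) * Real.sin t * Real.log t / t := by
      congr 1; funext t; ring
    rw [e1, e2] at hFTC
    linarith
  -- pass to the limit `N → ∞`
  have hintH : IntegrableOn (fun t : ℝ ↦ Real.exp (-(ε * t)) * H t) (Ioi 0) := by
    have hb : IntegrableOn (fun t : ℝ ↦ C * Real.exp (-(ε * t))) (Ioi 0) := by
      have h0 : IntegrableOn (fun t : ℝ ↦ C * Real.exp (-ε * t)) (Ioi 0) :=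
        (exp_neg_integrableOn_Ioi 0 hε).const_mul C
      exact h0.congr_fun (fun t _ ↦ by simp only [neg_mul]) measurableSet_Ioi
    refine hb.mono' ((hexpc.mul hHc).aestronglyMeasurable) ?_
    refine (ae_restrict_iff' measurableSet_Ioi).2 (Eventually.of_forall fun t ht ↦ ?_)
    have ht : 0 < t := ht
    rw [norm_mul, Real.norm_eq_abs, abs_of_pos (Real.exp_pos _), mul_comm]
    exact mul_le_mul_of_nonneg_right (hC t ht.le) (Real.exp_pos _).le
  have hlim1 : Tendsto (fun N : ℝ ↦ ∫ t in (0 : ℝ)..N, Real.exp (-(ε * t)) * Real.sin t * Real.log t / t)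
      atTop (𝓝 (∫ t in Ioi (0 : ℝ), Real.exp (-(ε * t)) * Real.sin t * Real.log t / t)) :=
    intervalIntegral_tendsto_integral_Ioi 0 (integrableOn_exp_neg_mul_sin_mul_log_div hε) tendsto_id
  have hlim2 : Tendsto (fun N : ℝ ↦ Real.exp (-(ε * N)) * H N +
      ε * ∫ t in (0 : ℝ)..N, Real.exp (-(ε * t)) * H t) atTop
      (𝓝 (0 + ε * ∫ t in Ioi (0 : ℝ), Real.exp (-(ε * t)) * H t)) := by
    refine Tendsto.add ?_ ((intervalIntegral_tendsto_integral_Ioi 0 hintH tendsto_id).const_mul ε)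
    have he : Tendsto (fun N : ℝ ↦ C * Real.exp (-(ε * N))) atTop (𝓝 0) := by
      have h := (Real.tendsto_exp_atBot.comp
        (tendsto_neg_atTop_atBot.comp (tendsto_id.const_mul_atTop hε)))
      simpa [Function.comp_def] using h.const_mul C
    refine squeeze_zero_norm' ?_ he
    filter_upwards [eventually_ge_atTop 0] with N hN
    rw [norm_mul, Real.norm_eq_abs, abs_of_pos (Real.exp_pos _), mul_comm]
    exact mul_le_mul_of_nonneg_right (hC N hN) (Real.exp_pos _).le
  rw [zero_add] at hlim2
  refine tendsto_nhds_unique hlim1 (hlim2.congr' ?_)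
  filter_upwards [eventually_ge_atTop 0] with N hN
  exact (hfin N hN).symm

/-- **The Abelian step**: if `H(T) → L` and `H` is bounded on `[0,∞)` then
`ε ∫₀^∞ e^{−εt} H(t) dt → L` as `ε → 0⁺` (substitute `t = u/ε`, dominated convergence). [folklore] -/
private theorem tendsto_eps_mul_integral_exp_neg_mul {H : ℝ → ℝ} (hHc : Continuous H) {L C : ℝ}
    (hH : Tendsto H atTop (𝓝 L)) (hC : ∀ T : ℝ, 0 ≤ T → ‖H T‖ ≤ C) :
    Tendsto (fun ε : ℝ ↦ ε * ∫ t in Ioi (0 : ℝ), Real.exp (-(ε * t)) * H t) (𝓝[>] 0) (𝓝 L) := by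
  -- substitution `t = u/ε`
  have hsub : ∀ ε : ℝ, 0 < ε → ε * ∫ t in Ioi (0 : ℝ), Real.exp (-(ε * t)) * H t =
      ∫ u in Ioi (0 : ℝ), Real.exp (-u) * H (u / ε) := by
    intro ε hε
    have h := integral_comp_mul_left_Ioi (fun u : ℝ ↦ Real.exp (-u) * H (u / ε)) 0 hε
    simp only [mul_zero, smul_eq_mul] at h
    have h' : ∫ x in Ioi (0 : ℝ), Real.exp (-(ε * x)) * H (ε * x / ε) =
        ∫ t in Ioi (0 : ℝ), Real.exp (-(ε * t)) * H t := by
      refine setIntegral_congr_fun measurableSet_Ioi fun x _ ↦ ?_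
      rw [mul_div_cancel_left₀ _ hε.ne']
    rw [← h', h, ← mul_assoc, mul_inv_cancel₀ hε.ne', one_mul]
  -- dominated convergence along `𝓝[>] 0`
  have hlim : Tendsto (fun ε : ℝ ↦ ∫ u in Ioi (0 : ℝ), Real.exp (-u) * H (u / ε)) (𝓝[>] 0)
      (𝓝 (∫ u in Ioi (0 : ℝ), Real.exp (-u) * L)) := by
    refine tendsto_integral_filter_of_dominated_convergence (fun u ↦ C * Real.exp (-u)) ?_ ?_ ?_ ?_
    · filter_upwards [self_mem_nhdsWithin] with ε hε
      exact ((Real.continuous_exp.comp continuous_neg).mul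
        (hHc.comp (continuous_id.div_const ε))).aestronglyMeasurable
    · filter_upwards [self_mem_nhdsWithin] with ε hε
      have hε : 0 < ε := hε
      refine (ae_restrict_iff' measurableSet_Ioi).2 (Eventually.of_forall fun u hu ↦ ?_)
      have hu : 0 < u := hu
      rw [norm_mul, Real.norm_eq_abs, abs_of_pos (Real.exp_pos _), mul_comm]
      exact mul_le_mul_of_nonneg_right (hC (u / ε) (div_pos hu hε).le) (Real.exp_pos _).le
    · have h0 : IntegrableOn (fun u : ℝ ↦ C * Real.exp (-1 * u)) (Ioi 0) :=
        (exp_neg_integrableOn_Ioi 0 zero_lt_one).const_mul C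
      exact h0.congr_fun (fun u _ ↦ by simp only [neg_mul, one_mul]) measurableSet_Ioi
    · refine (ae_restrict_iff' measurableSet_Ioi).2 (Eventually.of_forall fun u hu ↦ ?_)
      have hu : 0 < u := hu
      refine Tendsto.const_mul _ (hH.comp ?_)
      have h := tendsto_inv_nhdsGT_zero.const_mul_atTop hu
      refine h.congr' (Eventually.of_forall fun ε ↦ ?_)
      simp [div_eq_mul_inv]
  have hval : ∫ u in Ioi (0 : ℝ), Real.exp (-u) * L = L := by
    rw [MeasureTheory.integral_mul_const, integral_exp_neg_Ioi_zero, one_mul]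
  rw [hval] at hlim
  refine hlim.congr' ?_
  filter_upwards [self_mem_nhdsWithin] with ε hε
  exact (hsub ε hε).symm

/-- **`∫₀^T sin t · log t / t dt → −(π/2) γ` as `T → ∞`** — the conditionally convergent
Gradshteyn–Ryzhik integral `∫₀^∞ ln x sin x dx/x = −(π/2) γ`, obtained from the damped closed form
of Part A by the Abelian step. [cite: GradshteynRyzhik2015, 4.421 1; Boyadzhiev2020, §4 (chunk p0073:L12–L22)] -/
theorem tendsto_intervalIntegral_sin_mul_log_div :
    Tendsto (fun T : ℝ ↦ ∫ t in (0 : ℝ)..T, Real.sin t * Real.log t / t) atTop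
      (𝓝 (-(π / 2 * Real.eulerMascheroniConstant))) := by
  have hH := tendsto_primitive_sin_mul_log_div
  obtain ⟨C, hC⟩ := exists_bound_primitive_sin_mul_log_div
  have hA := tendsto_eps_mul_integral_exp_neg_mul continuous_primitive_sin_mul_log_div hH hC
  have hkey : Tendsto (fun ε : ℝ ↦ ∫ t in Ioi (0 : ℝ), Real.exp (-(ε * t)) * Real.sin t * Real.log t / t)
      (𝓝[>] 0) (𝓝 ((∫ t in (0 : ℝ)..1, Real.sin t * Real.log t / t) +
        ∫ t in Ioi (1 : ℝ), Real.cos t * (1 - Real.log t) / t ^ 2)) := by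
    refine hA.congr' ?_
    filter_upwards [self_mem_nhdsWithin] with ε hε
    exact (integral_exp_neg_mul_sin_mul_log_div_eq_primitive hε).symm
  have huniq := tendsto_nhds_unique hkey tendsto_integral_exp_neg_mul_sin_mul_log_div
  rw [huniq] at hH
  exact hH

end Abelian

/-! ## Part C. `∫₀^T Si(w)/w dw − (π/2) log T → (π/2) γ` -/

section SiLog

/-- `Si(w) · log w → 0` as `w → 0⁺` (`|Si w| ≤ |w|` and `w log w → 0`). [folklore] -/
private theorem tendsto_sinIntegral_mul_log_nhdsWithin_zero :
    Tendsto (fun w : ℝ ↦ sinIntegral w * Real.log w) (𝓝[>] 0) (𝓝 0) := by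
  have h : Tendsto (fun w : ℝ ↦ Real.log w * w ^ (1 : ℝ)) (𝓝[>] 0) (𝓝 0) :=
    tendsto_log_mul_rpow_nhdsGT_zero zero_lt_one
  refine squeeze_zero_norm' ?_ (tendsto_norm_zero.comp h)
  filter_upwards [self_mem_nhdsWithin] with w hw
  have hw : 0 < w := hw
  rw [Function.comp_apply, Real.rpow_one, norm_mul, norm_mul, mul_comm ‖Real.log w‖,
    Real.norm_eq_abs, Real.norm_eq_abs, Real.norm_eq_abs]
  exact mul_le_mul_of_nonneg_right (abs_sinIntegral_le w) (abs_nonneg _)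

/-- **Integration by parts for the `Si`-logarithmic integral** (`T > 0`):
`∫₀^T Si(w)/w dw = Si(T) log T − ∫₀^T sin w · log w / w dw`
(`d/dw [Si(w) log w] = sin w log w / w + Si(w)/w`, `Si(w) log w → 0` at `0⁺`).
[cite: ConnesConsani2021, §2 p. 11 (chunk p0011:L10), the `Si`-terms of `δ(ρ)`; Jeffrey1995, §9.2.5 eq. 2 (p0133:L32) integration by parts] -/
theorem integral_sinIntegral_div_eq {T : ℝ} (hT : 0 < T) :
    ∫ w in (0 : ℝ)..T, sinIntegral w / w =
      sinIntegral T * Real.log T - ∫ w in (0 : ℝ)..T, Real.sin w * Real.log w / w := by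
  have hderiv : ∀ w ∈ Ioo 0 T, HasDerivAt (fun w : ℝ ↦ sinIntegral w * Real.log w)
      (Real.sin w * Real.log w / w + sinIntegral w / w) w := by
    intro w hw
    have hw0 : w ≠ 0 := hw.1.ne'
    have h := (hasDerivAt_sinIntegral w).mul (Real.hasDerivAt_log hw0)
    refine h.congr_deriv ?_
    rw [Real.sinc_of_ne_zero hw0]
    field_simp
  have hcont : ContinuousOn (fun w : ℝ ↦ sinIntegral w * Real.log w) (Icc 0 T) := by
    intro w hw
    rcases eq_or_lt_of_le hw.1 with h0 | hpos
    · rw [← h0]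
      have hIci : ContinuousWithinAt (fun w : ℝ ↦ sinIntegral w * Real.log w) (Ici 0) 0 := by
        rw [← continuousWithinAt_Ioi_iff_Ici, ContinuousWithinAt, sinIntegral_zero, zero_mul]
        exact tendsto_sinIntegral_mul_log_nhdsWithin_zero
      exact hIci.mono Icc_subset_Ici_self
    · exact ((continuous_sinIntegral.continuousAt).mul
        (Real.continuousAt_log hpos.ne')).continuousWithinAt
  have hSi : IntervalIntegrable (fun w : ℝ ↦ sinIntegral w / w) volume 0 T := by
    refine (intervalIntegrable_const (c := (1 : ℝ))).mono_fun'
      ((continuous_sinIntegral.measurable).div measurable_id).aestronglyMeasurable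
      (Eventually.of_forall fun w ↦ ?_)
    show ‖sinIntegral w / w‖ ≤ 1
    rw [Real.norm_eq_abs]
    exact abs_sinIntegral_div_self_le w
  have hint : IntervalIntegrable (fun w : ℝ ↦
      Real.sin w * Real.log w / w + sinIntegral w / w) volume 0 T :=
    (intervalIntegrable_sin_mul_log_div 0 T).add hSi
  have hFTC := intervalIntegral.integral_eq_sub_of_hasDerivAt_of_le hT.le hcont hderiv hint
  rw [intervalIntegral.integral_add (intervalIntegrable_sin_mul_log_div 0 T) hSi] at hFTC
  simp only [sinIntegral_zero, zero_mul, sub_zero] at hFTC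
  linarith

/-- **The logarithmic asymptotics of `∫₀^T Si(w)/w dw`** (input «W2» of the cut-off scaling-kernel
blueprint, in the form the lead writer typed it):
`∫₀^T Si(w)/w dw − (π/2) log T → (π/2) γ` as `T → ∞`.
Proof: `∫₀^T Si/w = Si(T) log T − ∫₀^T sin·log/w` (`integral_sinIntegral_div_eq`),
`log T · (Si T − π/2) → 0` (`tendsto_log_mul_sinIntegral_sub`, seat t2) and
`∫₀^T sin w log w / w dw → −(π/2)γ` (`tendsto_intervalIntegral_sin_mul_log_div`, Part B).
[cite: GradshteynRyzhik2015, 4.421 1; ConnesConsani2021, §2 p. 11 (chunk p0011:L10) and §5.2/App. B (the constant `log 4π + γ` of the archimedean functional)] -/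
theorem tendsto_integral_sinIntegral_div_sub_log :
    Tendsto (fun T ↦ (∫ w in (0 : ℝ)..T, sinIntegral w / w) - π / 2 * Real.log T) atTop
      (𝓝 (π / 2 * Real.eulerMascheroniConstant)) := by
  have h1 := tendsto_log_mul_sinIntegral_sub
  have h2 := tendsto_intervalIntegral_sin_mul_log_div
  have h := h1.sub h2
  rw [show (0 : ℝ) - -(π / 2 * Real.eulerMascheroniConstant) = π / 2 * Real.eulerMascheroniConstant
    by ring] at h
  refine h.congr' ?_
  filter_upwards [eventually_gt_atTop 0] with T hT
  rw [integral_sinIntegral_div_eq hT]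
  ring

end SiLog

/-! ## Part D. Explicit forms: `log(1/(ε−i)) = −½ log(1+ε²) + i(π/2 − arctan ε)` and the damped
Dirichlet integral `∫₀^∞ e^{−εt} sin t / t dt = π/2 − arctan ε` -/

section Explicit

/-- `Re log(1/(ε − i)) = −½ log(1 + ε²)` (principal branch; `|1/(ε−i)| = (1+ε²)^{−1/2}`).
[cite: Jeffrey1995, §1.1.1.1 (modulus of a complex number) (p0034:L24); Boyadzhiev2020, §4 (chunk p0073:L12–L22)] -/
theorem re_log_one_div_ofReal_sub_I (ε : ℝ) :
    (Complex.log (1 / ((ε : ℂ) - I))).re = -(Real.log (1 + ε ^ 2) / 2) := by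
  rw [Complex.log_re, norm_div, norm_one, Complex.norm_eq_sqrt_sq_add_sq]
  simp only [Complex.sub_re, Complex.ofReal_re, Complex.I_re, sub_zero, Complex.sub_im,
    Complex.ofReal_im, Complex.I_im, zero_sub, even_two, Even.neg_pow, one_pow]
  rw [one_div, Real.log_inv, Real.log_sqrt (by positivity), add_comm]

/-- `Im log(1/(ε − i)) = arg(1/(ε − i)) = π/2 − arctan ε` for `ε > 0` (principal branch).
[cite: Boyadzhiev2020, §2 eq. (2.1) (chunk p0024:L11); Jeffrey1995, §1.1.1.1 (p0034:L24)] -/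
theorem im_log_one_div_ofReal_sub_I {ε : ℝ} (hε : 0 < ε) :
    (Complex.log (1 / ((ε : ℂ) - I))).im = π / 2 - Real.arctan ε := by
  have hns : Complex.normSq ((ε : ℂ) - I) = ε ^ 2 + 1 := by
    simp [Complex.normSq_apply]; ring
  have hre : ((1 : ℂ) / ((ε : ℂ) - I)).re = ε / (ε ^ 2 + 1) := by
    rw [Complex.div_re, hns]; simp
  have him : ((1 : ℂ) / ((ε : ℂ) - I)).im = 1 / (ε ^ 2 + 1) := by
    rw [Complex.div_im, hns]; simp [neg_div]
  have hnorm : ‖(1 : ℂ) / ((ε : ℂ) - I)‖ = 1 / Real.sqrt (ε ^ 2 + 1) := by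
    rw [norm_div, norm_one, Complex.norm_eq_sqrt_sq_add_sq]
    simp [Complex.sub_re, Complex.sub_im]
  rw [Complex.log_im, Complex.arg_of_re_nonneg (by rw [hre]; positivity), him, hnorm,
    ← Real.arctan_inv_of_pos hε, Real.arctan_eq_arcsin]
  congr 1
  have hs : Real.sqrt (1 + ε⁻¹ ^ 2) = Real.sqrt (ε ^ 2 + 1) / ε := by
    rw [show (1 + ε⁻¹ ^ 2 : ℝ) = (ε ^ 2 + 1) / ε ^ 2 by field_simp,
      Real.sqrt_div' _ (sq_nonneg ε), Real.sqrt_sq hε.le]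
  rw [hs]
  have hsq : Real.sqrt (ε ^ 2 + 1) ≠ 0 := (Real.sqrt_pos.2 (by positivity)).ne'
  field_simp
  rw [Real.sq_sqrt (by positivity)]

/-- **The damped sine–log integral, explicit form** (`ε > 0`):
`∫₀^∞ e^{−εt} sin t · log t / t dt = −(π/2 − arctan ε) · (½ log(1 + ε²) + γ)`
(`π/2 − arctan ε = arctan(1/ε)`; the form announced with W2).
[cite: Boyadzhiev2020, §2 eq. (2.1) (chunk p0024:L11) and §4 (chunk p0073:L12–L22); GradshteynRyzhik2015, 4.421 1 (ε → 0⁺)] -/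
theorem integral_exp_neg_mul_sin_mul_log_div_explicit {ε : ℝ} (hε : 0 < ε) :
    ∫ t in Ioi (0 : ℝ), Real.exp (-(ε * t)) * Real.sin t * Real.log t / t =
      -((π / 2 - Real.arctan ε) * (Real.log (1 + ε ^ 2) / 2 + Real.eulerMascheroniConstant)) := by
  rw [integral_exp_neg_mul_sin_mul_log_div hε, re_log_one_div_ofReal_sub_I,
    im_log_one_div_ofReal_sub_I hε]
  ring

/-- **The damped Dirichlet integral** (`ε > 0`): `∫₀^∞ e^{−εt} sin t / t dt = π/2 − arctan ε`
(Boyadzhiev eq. (2.1): "`∫₀^∞ e^{−λx} (sin x/x) dx = π/2 − arctan λ`"), here as the value at `a = 0`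
of the Mellin transform of the damped sine, by continuity from the closed form at real `a > 0`.
[cite: Boyadzhiev2020, §2 eq. (2.1) (chunk p0024:L11)] -/
theorem integral_exp_neg_mul_sin_div {ε : ℝ} (hε : 0 < ε) :
    ∫ t in Ioi (0 : ℝ), Real.exp (-(ε * t)) * Real.sin t / t = π / 2 - Real.arctan ε := by
  set ρ := (Complex.log (1 / ((ε : ℂ) - I))).re with hρ
  set φ := (Complex.log (1 / ((ε : ℂ) - I))).im with hφ
  set f : ℝ → ℂ := fun t ↦ (((Real.exp (-(ε * t)) * Real.sin t : ℝ)) : ℂ) with hf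
  set M : ℝ → ℝ := fun a ↦ Real.Gamma (a + 1) * Real.exp (a * ρ) * (φ * Real.sinc (a * φ)) with hM
  obtain ⟨-, hder⟩ := hasDerivAt_mellin_dampedSin hε
  have hreal : ∀ a : ℝ, 0 < a → mellin f (a : ℂ) = ((M a : ℝ) : ℂ) := by
    intro a ha
    rw [hf, mellin_dampedSin_ofReal_eq_integral, integral_rpow_mul_exp_neg_mul_sin_eq hε ha]
  have hMderiv : HasDerivAt M ((ρ - Real.eulerMascheroniConstant) * φ) 0 :=
    hasDerivAt_productForm_zero ρ φ
  have hder' : HasDerivAt (mellin f) (mellin (fun t : ℝ ↦ (Real.log t : ℂ) • f t) 0)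
      ((0 : ℝ) : ℂ) := by
    rw [Complex.ofReal_zero]; exact hder
  have h0 : mellin f ((0 : ℝ) : ℂ) = ((M 0 : ℝ) : ℂ) := by
    have h1 : Tendsto (fun a : ℝ ↦ mellin f (a : ℂ)) (𝓝[>] 0) (𝓝 (mellin f ((0 : ℝ) : ℂ))) :=
      (hder'.continuousAt.tendsto.comp (Complex.continuous_ofReal.tendsto 0)).mono_left
        nhdsWithin_le_nhds
    have h2 : Tendsto (fun a : ℝ ↦ mellin f (a : ℂ)) (𝓝[>] 0) (𝓝 ((M 0 : ℝ) : ℂ)) := by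
      have hc : Tendsto (fun a : ℝ ↦ ((M a : ℝ) : ℂ)) (𝓝[>] 0) (𝓝 ((M 0 : ℝ) : ℂ)) :=
        ((Complex.continuous_ofReal.tendsto (M 0)).comp hMderiv.continuousAt.tendsto).mono_left
          nhdsWithin_le_nhds
      refine hc.congr' ?_
      filter_upwards [self_mem_nhdsWithin] with a ha
      exact (hreal a ha).symm
    exact tendsto_nhds_unique h1 h2
  have hM0 : M 0 = φ := by simp [hM]
  rw [hM0, hf, mellin_dampedSin_ofReal_eq_integral, Complex.ofReal_inj] at h0
  rw [← im_log_one_div_ofReal_sub_I hε, ← hφ, ← h0]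
  refine setIntegral_congr_fun measurableSet_Ioi fun t ht ↦ ?_
  have ht : 0 < t := ht
  rw [zero_sub, Real.rpow_neg_one]
  field_simp

end Explicit

/-! ## Part E. The Laplace transform of the sine integral: `∫₀^∞ e^{−εt} Si(t) dt = (π/2 − arctan ε)/ε` -/

section LaplaceSi

/-- `|Si(x)| ≤ 4` on `[0, ∞)` (`|Si x| ≤ x` for `x ≤ 1`, `|Si x − π/2| ≤ 2/x` for `x ≥ 1`). [folklore] -/
private theorem abs_sinIntegral_le_four {x : ℝ} (hx : 0 ≤ x) : |sinIntegral x| ≤ 4 := by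
  rcases le_or_gt x 1 with h | h
  · exact (abs_sinIntegral_le x).trans (by rw [abs_of_nonneg hx]; linarith)
  · have h1 := abs_sinIntegral_sub_pi_div_two_le (by linarith : (0 : ℝ) < x)
    have h2 : 2 / x ≤ 2 := by rw [div_le_iff₀ (by linarith)]; linarith
    have h3 : |sinIntegral x| ≤ |sinIntegral x - π / 2| + |π / 2| := by
      have := abs_add_le (sinIntegral x - π / 2) (π / 2)
      rwa [sub_add_cancel] at this
    have h4 : |π / 2| ≤ 2 := by
      rw [abs_of_pos (by positivity)]; linarith [Real.pi_lt_four]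
    linarith

/-- **The Laplace transform of the sine integral** (`ε > 0`):
`∫₀^∞ e^{−εt} Si(t) dt = (π/2 − arctan ε)/ε` — integration by parts against `−e^{−εt}/ε` and the
damped Dirichlet integral `∫₀^∞ e^{−εt} sin t/t dt = π/2 − arctan ε` (`integral_exp_neg_mul_sin_div`).
[cite: Boyadzhiev2020, §2 eq. (2.1) (chunk p0024:L11) (the damped Dirichlet integral; the `Si` form by parts); Jeffrey1995, §9.2.5 eq. 2 (p0133:L32) integration by parts] -/
theorem integral_exp_neg_mul_sinIntegral {ε : ℝ} (hε : 0 < ε) :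
    ∫ t in Ioi (0 : ℝ), Real.exp (-(ε * t)) * sinIntegral t = (π / 2 - Real.arctan ε) / ε := by
  have hexpc : Continuous fun t : ℝ ↦ Real.exp (-(ε * t)) := by fun_prop
  -- integrability of both integrands on `(0, ∞)`
  have hint1 : IntegrableOn (fun t : ℝ ↦ Real.exp (-(ε * t)) * sinIntegral t) (Ioi 0) := by
    have h0 : IntegrableOn (fun t : ℝ ↦ 4 * Real.exp (-(ε * t))) (Ioi 0) := by
      have h00 : IntegrableOn (fun t : ℝ ↦ 4 * Real.exp (-ε * t)) (Ioi 0) :=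
        (exp_neg_integrableOn_Ioi 0 hε).const_mul 4
      refine h00.congr_fun (fun t _ ↦ ?_) measurableSet_Ioi
      simp only [neg_mul]
    refine h0.mono' ((hexpc.mul continuous_sinIntegral).aestronglyMeasurable) ?_
    refine (ae_restrict_iff' measurableSet_Ioi).2 (Eventually.of_forall fun t ht ↦ ?_)
    have ht : 0 < t := ht
    rw [norm_mul, Real.norm_eq_abs, Real.norm_eq_abs, abs_of_pos (Real.exp_pos _), mul_comm]
    exact mul_le_mul_of_nonneg_right (abs_sinIntegral_le_four ht.le) (Real.exp_pos _).le
  have hint2 : IntegrableOn (fun t : ℝ ↦ Real.exp (-(ε * t)) * Real.sin t / t) (Ioi 0) := by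
    have h0 : IntegrableOn (fun t : ℝ ↦ 1 * Real.exp (-(ε * t))) (Ioi 0) := by
      have h00 : IntegrableOn (fun t : ℝ ↦ 1 * Real.exp (-ε * t)) (Ioi 0) :=
        (exp_neg_integrableOn_Ioi 0 hε).const_mul 1
      refine h00.congr_fun (fun t _ ↦ ?_) measurableSet_Ioi
      simp only [neg_mul]
    refine h0.mono'
      (((hexpc.measurable.mul Real.measurable_sin).div measurable_id).aestronglyMeasurable) ?_
    refine (ae_restrict_iff' measurableSet_Ioi).2 (Eventually.of_forall fun t ht ↦ ?_)
    have ht : 0 < t := ht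
    rw [Real.norm_eq_abs, abs_div, abs_mul, abs_of_pos (Real.exp_pos _), mul_div_assoc, ← abs_div,
      one_mul]
    exact mul_le_of_le_one_right (Real.exp_pos _).le (abs_sin_div_self_le_one t)
  -- integration by parts on `[0, N]`
  have hfin : ∀ N : ℝ, 0 ≤ N → ∫ t in (0 : ℝ)..N, Real.exp (-(ε * t)) * sinIntegral t =
      -(Real.exp (-(ε * N)) / ε * sinIntegral N) +
        (1 / ε) * ∫ t in (0 : ℝ)..N, Real.exp (-(ε * t)) * Real.sin t / t := by
    intro N hN
    have hderiv : ∀ t ∈ Ioo 0 N, HasDerivAt (fun t : ℝ ↦ -(Real.exp (-(ε * t)) / ε) * sinIntegral t)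
        (Real.exp (-(ε * t)) * sinIntegral t + -(Real.exp (-(ε * t)) / ε) * (Real.sin t / t)) t := by
      intro t ht
      have h1 : HasDerivAt (fun t : ℝ ↦ -(Real.exp (-(ε * t)) / ε)) (Real.exp (-(ε * t))) t := by
        have h0 : HasDerivAt (fun t : ℝ ↦ -(ε * t)) (-ε) t := by
          simpa [neg_mul] using (hasDerivAt_id t).const_mul (-ε)
        have := (h0.exp.div_const ε).neg
        refine this.congr_deriv ?_
        field_simp
      have h2 := hasDerivAt_sinIntegral t
      have h3 := h1.mul h2
      refine h3.congr_deriv ?_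
      rw [Real.sinc_of_ne_zero ht.1.ne']
    have hcont : ContinuousOn (fun t : ℝ ↦ -(Real.exp (-(ε * t)) / ε) * sinIntegral t) (Icc 0 N) :=
      ((hexpc.div_const ε).neg.mul continuous_sinIntegral).continuousOn
    have hi1 : IntervalIntegrable (fun t : ℝ ↦ Real.exp (-(ε * t)) * sinIntegral t) volume 0 N :=
      (hexpc.mul continuous_sinIntegral).intervalIntegrable 0 N
    have hi2 : IntervalIntegrable (fun t : ℝ ↦ -(Real.exp (-(ε * t)) / ε) * (Real.sin t / t))
        volume 0 N :=
      (intervalIntegrable_sin_div_self 0 N).continuousOn_mul ((hexpc.div_const ε).neg.continuousOn)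
    have hFTC := intervalIntegral.integral_eq_sub_of_hasDerivAt_of_le hN hcont hderiv (hi1.add hi2)
    rw [intervalIntegral.integral_add hi1 hi2] at hFTC
    simp only [sinIntegral_zero, mul_zero, sub_zero] at hFTC
    have e2 : ∫ t in (0 : ℝ)..N, -(Real.exp (-(ε * t)) / ε) * (Real.sin t / t) =
        -((1 / ε) * ∫ t in (0 : ℝ)..N, Real.exp (-(ε * t)) * Real.sin t / t) := by
      rw [← intervalIntegral.integral_const_mul, ← intervalIntegral.integral_neg]
      congr 1; funext t; field_simp
    rw [e2] at hFTC
    linarith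
  -- `N → ∞`
  have hlim1 := intervalIntegral_tendsto_integral_Ioi 0 hint1 tendsto_id
  have hlim2 : Tendsto (fun N : ℝ ↦ -(Real.exp (-(ε * N)) / ε * sinIntegral N) +
      (1 / ε) * ∫ t in (0 : ℝ)..N, Real.exp (-(ε * t)) * Real.sin t / t) atTop
      (𝓝 (-0 + (1 / ε) * ∫ t in Ioi (0 : ℝ), Real.exp (-(ε * t)) * Real.sin t / t)) := by
    refine (Tendsto.neg ?_).add ((intervalIntegral_tendsto_integral_Ioi 0 hint2 tendsto_id).const_mul _)
    have he : Tendsto (fun N : ℝ ↦ 4 / ε * Real.exp (-(ε * N))) atTop (𝓝 0) := by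
      have h := (Real.tendsto_exp_atBot.comp
        (tendsto_neg_atTop_atBot.comp (tendsto_id.const_mul_atTop hε)))
      simpa [Function.comp_def] using h.const_mul (4 / ε)
    refine squeeze_zero_norm' ?_ he
    filter_upwards [eventually_ge_atTop 0] with N hN
    rw [norm_mul, norm_div, Real.norm_eq_abs, Real.norm_eq_abs, Real.norm_eq_abs,
      abs_of_pos (Real.exp_pos _), abs_of_pos hε]
    calc Real.exp (-(ε * N)) / ε * |sinIntegral N| ≤ Real.exp (-(ε * N)) / ε * 4 :=
          mul_le_mul_of_nonneg_left (abs_sinIntegral_le_four hN) (by positivity)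
      _ = 4 / ε * Real.exp (-(ε * N)) := by ring
  rw [neg_zero, zero_add, integral_exp_neg_mul_sin_div hε] at hlim2
  have := tendsto_nhds_unique hlim1 (hlim2.congr' ?_)
  · rw [this]; field_simp
  · filter_upwards [eventually_ge_atTop 0] with N hN
    exact (hfin N hN).symm

end LaplaceSi

end Literature.NumberTheory.ConnesConsani2021

end
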